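import Summits.AtomisticToContinuum.HydrodynamicLimit.Theorems.RelayRaceLocalityRestartPrincipleStaticAnchor
import Summits.AtomisticToContinuum.HydrodynamicLimit.Theorems.RelayRaceLocalityRestartPrincipleRenyiReduction
import Summits.AtomisticToContinuum.HydrodynamicLimit.Theorems.RelayRaceLocalityRestartPrincipleLineGlue
import Literature.Probability.Divergences.RenyiDivergence
import Mathlib.MeasureTheory.Integral.MeanInequalities
import HarnessLib

/-!
# Crux `RestartPrinciple` (stmt-AtomisticToContinuum-12503), line `isentropic-regibbsification` —
# TIGHTNESS of the first split: Rényi short-time local equilibrium ⟹ `stub_noAnomalousDissipation`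

Lead c5. The reduction (R2, `renyiLocalEquilibriumLDA_of`, p117955) derives the line's original bet — the
Rényi-`(1+γ)` short-time local equilibrium of the fresh LDA gas, `∀ ε ∃ γ ∀ᶠ N, D_{1+γ}((Φ_{t-s})_# G_s ‖ G_t)
≤ ε(N+1)` — from the one-sided large-deviation bet S4a (`stub_noAnomalousDissipation`) and landed statics.
This file proves the CONVERSE (`noAnomalousDissipation_of_renyiLocalEquilibrium`): the Rényi statement
(taken verbatim as the hypothesis `hR`) implies S4a verbatim. Hence, modulo CLOSED statics, the registered
stub is EQUIVALENT to the Rényi short-time local equilibrium of the LDA gas — c4's split lost nothing and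
gained nothing: the residue of the line is exactly "Rényi local equilibrium in short time from exact local
Gibbs data", for deterministic hard spheres.

Proof: the Rényi change of measure for events (`measure_le_hellinger_rpow_mul_rpow`, Hölder):
`P(A) ≤ H_{1+γ}(P‖Q)^{1/(1+γ)} · Q(A)^{γ/(1+γ)}`, with `H ≤ e^{γ ε (N+1)}` from the Rényi bound
(`hellingerIntegral_le_of_renyiDiv_le`) and `Q(A) = G_t{b_t < b̄_t − δ} ≤ C_t e^{-(N+1)/C_t}` from the
STATIC ANCHOR (`noAnomalousDissipation_static`, file `…StaticAnchor`); choosing `ε = 1/(2C_t)` leaves the rate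
`γ/(2C_t(1+γ))`, and the finitely many small `N` are absorbed in the constant. No definitions, no `sorry`.
-/

noncomputable section

open Literature.MathematicalPhysics.KineticTheory Literature.Analysis.FluidPDE
open Literature.Analysis.FunctionSpaces MeasureTheory Filter Set Topology
open Literature.Probability.Divergences InformationTheory
open scoped ENNReal

namespace Summit.AtomisticToContinuum.HydrodynamicLimit.Theorems.RestartPrinciple.IsentropicRegibbsification

/-! ## Rényi change of measure for events -/

/-- **Rényi change of measure for events** (Hölder): for `P ≪ Q`, `γ > 0` and a measurable `A`,
`P(A) ≤ H_{1+γ}(P ‖ Q)^{1/(1+γ)} · Q(A)^{1/(1+γ⁻¹)}`, `H_{1+γ}(P ‖ Q) = ∫ (dP/dQ)^{1+γ} dQ`.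
[cite: VanervenHarremoes2014, Def. 2] -/
theorem measure_le_hellinger_rpow_mul_rpow {Ω : Type*} [MeasurableSpace Ω] (P Q : Measure Ω)
    [IsFiniteMeasure P] [IsFiniteMeasure Q] (hPQ : P ≪ Q) {γ : ℝ} (hγ : 0 < γ) {A : Set Ω}
    (hA : MeasurableSet A) :
    P A ≤ hellingerIntegral (1 + γ) P Q ^ (1 / (1 + γ)) * Q A ^ (1 / (1 + γ⁻¹)) := by
  have hp : (0 : ℝ) < 1 + γ := by positivity
  have hp' : (0 : ℝ) < 1 + γ⁻¹ := by positivity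
  have hpq : (1 + γ : ℝ).HolderConjugate (1 + γ⁻¹) :=
    ⟨by rw [inv_one]; field_simp; ring, hp, hp'⟩
  have hf : AEMeasurable (P.rnDeriv Q) Q := (Measure.measurable_rnDeriv P Q).aemeasurable
  have hg : AEMeasurable (A.indicator fun _ => (1 : ℝ≥0∞)) Q :=
    (measurable_const.indicator hA).aemeasurable
  have h := ENNReal.lintegral_mul_le_Lp_mul_Lq Q hpq hf hg
  -- the left-hand side is `P A`
  have hlhs : ∫⁻ x, (P.rnDeriv Q * A.indicator fun _ => (1 : ℝ≥0∞)) x ∂Q = P A := by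
    have hpt : ∀ x, (P.rnDeriv Q * A.indicator fun _ => (1 : ℝ≥0∞)) x = A.indicator (P.rnDeriv Q) x := by
      intro x
      by_cases hx : x ∈ A
      · simp [hx]
      · simp [hx]
    rw [lintegral_congr hpt, lintegral_indicator hA, Measure.setLIntegral_rnDeriv hPQ]
  -- the two factors
  have hH : ∫⁻ x, P.rnDeriv Q x ^ (1 + γ) ∂Q = hellingerIntegral (1 + γ) P Q :=
    (hellingerIntegral_of_ac hPQ).symm
  have hQ : ∫⁻ x, (A.indicator fun _ => (1 : ℝ≥0∞)) x ^ (1 + γ⁻¹) ∂Q = Q A := by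
    have hpt : ∀ x, (A.indicator fun _ => (1 : ℝ≥0∞)) x ^ (1 + γ⁻¹) =
        A.indicator (fun _ => (1 : ℝ≥0∞)) x := by
      intro x
      by_cases hx : x ∈ A
      · simp [hx]
      · simp [hx, hp']
    rw [lintegral_congr hpt, lintegral_indicator_const hA, one_mul]
  rw [hlhs, hH, hQ] at h
  exact h

/-- **Hellinger bound from a Rényi bound** (converse of `renyiDiv_le_of_hellingerIntegral_le`): for
`γ > 0`, `b ≥ 0`, if `D_{1+γ}(μ ‖ ν) ≤ b` then `∫ (dμ/dν)^{1+γ} dν ≤ e^{γ b}` (and in particular it is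
finite). [cite: VanervenHarremoes2014, Def. 2] -/
theorem hellingerIntegral_le_of_renyiDiv_le {α : Type*} [MeasurableSpace α] {μ ν : Measure α} {γ b : ℝ}
    (hγ : 0 < γ) (hb : 0 ≤ b) (h : renyiDiv (1 + γ) μ ν ≤ ENNReal.ofReal b) :
    hellingerIntegral (1 + γ) μ ν ≤ ENNReal.ofReal (Real.exp (γ * b)) := by
  have hne1 : (1 + γ : ℝ) ≠ 1 := by intro h; linarith
  have hγ1 : (1 + γ : ℝ) - 1 = γ := by ring
  have hγinv : 0 < γ⁻¹ := inv_pos.2 hγ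
  set H : ℝ≥0∞ := hellingerIntegral (1 + γ) μ ν with hH_def
  have hRenyi : renyiDiv (1 + γ) μ ν = (((γ⁻¹ : ℝ) : EReal) * ENNReal.log H).toENNReal := by
    rw [renyiDiv_of_ne_one hne1, hγ1]
  -- `H` is finite
  have hHtop : H ≠ ∞ := by
    intro hH
    rw [hRenyi, hH, ENNReal.log_top, EReal.coe_mul_top_of_pos hγinv, EReal.toENNReal_top] at h
    exact absurd h (not_le.2 ENNReal.ofReal_lt_top)
  by_cases hH0 : H = 0
  · rw [hH0]; exact bot_le
  -- `γ⁻¹ log H ≤ b`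
  rw [hRenyi, ENNReal.log_pos_real hH0 hHtop, ← EReal.coe_mul, EReal.real_coe_toENNReal,
    ENNReal.ofReal_le_ofReal_iff hb] at h
  have hpos : 0 < H.toReal := ENNReal.toReal_pos hH0 hHtop
  have hlog : Real.log H.toReal ≤ γ * b := by
    have := mul_le_mul_of_nonneg_left h hγ.le
    rwa [← mul_assoc, mul_inv_cancel₀ hγ.ne', one_mul] at this
  have hle : H.toReal ≤ Real.exp (γ * b) := (Real.log_le_iff_le_exp hpos).1 hlog
  calc H = ENNReal.ofReal H.toReal := (ENNReal.ofReal_toReal hHtop).symm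
    _ ≤ ENNReal.ofReal (Real.exp (γ * b)) := ENNReal.ofReal_le_ofReal hle

/-- Real bookkeeping for the tightness step: with `K = C^{r}`, `r = 1/(1 + γ⁻¹)`,
`e^{γ b}^{1/(1+γ)} (C e^{-n/C})^{r} = K e^{-(r/(2C)) n}` when `b = n/(2C)`. [folklore] -/
theorem tightness_bookkeeping {γ C n : ℝ} (hγ : 0 < γ) (hC : 0 < C) :
    Real.exp (γ * (n / (2 * C))) ^ (1 / (1 + γ)) * (C * Real.exp (-(C⁻¹ * n))) ^ (1 / (1 + γ⁻¹)) =
      C ^ (1 / (1 + γ⁻¹)) * Real.exp (-(1 / (1 + γ⁻¹) / (2 * C) * n)) := by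
  have hp : (0 : ℝ) < 1 + γ := by positivity
  have hr : 1 / (1 + γ⁻¹) = γ / (1 + γ) := by
    field_simp
    ring
  rw [Real.mul_rpow hC.le (Real.exp_pos _).le, ← Real.exp_mul, ← Real.exp_mul, hr]
  rw [mul_comm (C ^ (γ / (1 + γ))), mul_assoc, mul_comm (C ^ (γ / (1 + γ))), ← mul_assoc,
    ← Real.exp_add]
  congr 1
  congr 1
  field_simp
  ring

/-! ## The tightness theorem -/

/-- **TIGHTNESS of the first split: Rényi short-time local equilibrium ⟹ `stub_noAnomalousDissipation`.**
The hypothesis `hR` is, verbatim, the conclusion of the landed reduction `renyiLocalEquilibriumLDA_of` (R2);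
the conclusion is, verbatim, the registered stub S4a. With (R2) this makes S4a EQUIVALENT (modulo closed
statics) to the Rényi short-time local equilibrium of the LDA gas. Proof: Rényi change of measure for the
event `{b_t < b̄_t − δ}` against the static anchor at time `t`, `ε := 1/(2C_t)`.
[cite: VanervenHarremoes2014, Def. 2; Yau1991, §1] -/
theorem noAnomalousDissipation_of_renyiLocalEquilibrium
    (hR : ∃ η₀ : ℝ, 0 < η₀ ∧ ∃ σ₀ : ℝ, 0 < σ₀ ∧ ∀ σ : ℝ, 0 < σ → σ < σ₀ → ∀ M : ℝ, 0 < M →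
      ∃ τ₁ : ℝ, 0 < τ₁ ∧ ∀ (T : ℝ) (ρ θ : ℝ → T3 → ℝ) (u : ℝ → T3 → V3),
      IsHardSphereEulerSolution σ T ρ u θ → (∀ s' ∈ Set.Ico 0 T, ∫ x, ρ s' x = 1) →
      ∀ Φ : (N : ℕ) → HardSphereFlow (Torus.geometry (Fin 3)) (hsDiameter σ N) (N + 1),
      ∀ s ∈ Set.Ico 0 T, ∀ t ∈ Set.Ico s (min T (s + τ₁)),
      (∀ s' ∈ Set.Icc s t, ∀ x, ρ s' x * σ ^ 3 < η₀ ∧ ρ s' x ≤ M ∧ θ s' x ≤ M ∧ M⁻¹ ≤ θ s' x ∧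
      ‖u s' x‖ ≤ M ∧ ∀ i j k : Fin 3, |Torus.partialDeriv i (ρ s') x| ≤ M ∧
      ‖Torus.partialDeriv i (u s') x‖ ≤ M ∧ |Torus.partialDeriv i (θ s') x| ≤ M ∧
      |Torus.partialDeriv i (Torus.partialDeriv j (ρ s')) x| ≤ M ∧
      ‖Torus.partialDeriv i (Torus.partialDeriv j (u s')) x‖ ≤ M ∧
      |Torus.partialDeriv i (Torus.partialDeriv j (θ s')) x| ≤ M ∧
      |Torus.partialDeriv i (Torus.partialDeriv j (Torus.partialDeriv k (ρ s'))) x| ≤ M ∧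
      ‖Torus.partialDeriv i (Torus.partialDeriv j (Torus.partialDeriv k (u s'))) x‖ ≤ M ∧
      |Torus.partialDeriv i (Torus.partialDeriv j (Torus.partialDeriv k (θ s'))) x| ≤ M) →
      ∀ ε : ℝ, 0 < ε → ∃ γ : ℝ, 0 < γ ∧ ∀ᶠ N : ℕ in atTop,
      renyiDiv (1 + γ)
      ((Φ N).lawAt (localGibbsLaw σ (fun x => ρ s x * Real.exp (hsExcessFreeEnergy (ρ s x * σ ^ 3) +
      ρ s x * σ ^ 3 * deriv hsExcessFreeEnergy (ρ s x * σ ^ 3))) (u s) (θ s) N (Φ N)) (t - s))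
      (localGibbsLaw σ (fun x => ρ t x * Real.exp (hsExcessFreeEnergy (ρ t x * σ ^ 3) +
      ρ t x * σ ^ 3 * deriv hsExcessFreeEnergy (ρ t x * σ ^ 3))) (u t) (θ t) N (Φ N)) ≤
      ENNReal.ofReal ε * ((N : ℝ≥0∞) + 1)) :
    ∃ η₀ : ℝ, 0 < η₀ ∧ ∃ σ₀ : ℝ, 0 < σ₀ ∧ ∀ σ : ℝ, 0 < σ → σ < σ₀ → ∀ M : ℝ, 0 < M →
      ∃ τ₁ : ℝ, 0 < τ₁ ∧ ∀ (T : ℝ) (ρ θ : ℝ → T3 → ℝ) (u : ℝ → T3 → V3),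
      IsHardSphereEulerSolution σ T ρ u θ → (∀ s' ∈ Set.Ico 0 T, ∫ x, ρ s' x = 1) →
      ∀ Φ : (N : ℕ) → HardSphereFlow (Torus.geometry (Fin 3)) (hsDiameter σ N) (N + 1),
      ∀ s ∈ Set.Ico 0 T, ∀ t ∈ Set.Ico s (min T (s + τ₁)),
      (∀ s' ∈ Set.Icc s t, ∀ x, ρ s' x * σ ^ 3 < η₀ ∧ ρ s' x ≤ M ∧ θ s' x ≤ M ∧ M⁻¹ ≤ θ s' x ∧
      ‖u s' x‖ ≤ M ∧ ∀ i j k : Fin 3, |Torus.partialDeriv i (ρ s') x| ≤ M ∧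
      ‖Torus.partialDeriv i (u s') x‖ ≤ M ∧ |Torus.partialDeriv i (θ s') x| ≤ M ∧
      |Torus.partialDeriv i (Torus.partialDeriv j (ρ s')) x| ≤ M ∧
      ‖Torus.partialDeriv i (Torus.partialDeriv j (u s')) x‖ ≤ M ∧
      |Torus.partialDeriv i (Torus.partialDeriv j (θ s')) x| ≤ M ∧
      |Torus.partialDeriv i (Torus.partialDeriv j (Torus.partialDeriv k (ρ s'))) x| ≤ M ∧
      ‖Torus.partialDeriv i (Torus.partialDeriv j (Torus.partialDeriv k (u s'))) x‖ ≤ M ∧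
      |Torus.partialDeriv i (Torus.partialDeriv j (Torus.partialDeriv k (θ s'))) x| ≤ M) →
      ∀ δ : ℝ, 0 < δ → ∃ C : ℝ, 0 < C ∧ ∀ N : ℕ,
      localGibbsLaw σ (fun x => ρ s x * Real.exp (hsExcessFreeEnergy (ρ s x * σ ^ 3) +
      ρ s x * σ ^ 3 * deriv hsExcessFreeEnergy (ρ s x * σ ^ 3))) (u s) (θ s) N (Φ N)
      {z | ((N : ℝ) + 1)⁻¹ * ∑ i, Real.log (localGibbsProfile
      (fun x => ρ t x * Real.exp (hsExcessFreeEnergy (ρ t x * σ ^ 3) +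
      ρ t x * σ ^ 3 * deriv hsExcessFreeEnergy (ρ t x * σ ^ 3))) (u t) (θ t)
      ((Φ N).flow (t - s) z i)) <
      (∫ x, ρ t x * (Real.log (ρ t x * Real.exp (hsExcessFreeEnergy (ρ t x * σ ^ 3) +
      ρ t x * σ ^ 3 * deriv hsExcessFreeEnergy (ρ t x * σ ^ 3))) -
      3 / 2 * Real.log (2 * Real.pi * θ t x) - 3 / 2)) - δ} ≤
      ENNReal.ofReal (C * Real.exp (-(C⁻¹ * (N + 1)))) := by
  obtain ⟨ηR, hηR, σR, hσR, hRR⟩ := hR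
  obtain ⟨ηS, hηS, hS⟩ := noAnomalousDissipation_static
  obtain ⟨ηE, hηE, -, hfc, hdc⟩ := exists_eos_band
  refine ⟨min ηR (min ηS ηE), lt_min hηR (lt_min hηS hηE), min σR (1 / 2), lt_min hσR one_half_pos,
    fun σ hσ hσlt M hM => ?_⟩
  have hσR' : σ < σR := lt_of_lt_of_le hσlt (min_le_left _ _)
  have hσ2 : σ ≤ 1 / 2 := (lt_of_lt_of_le hσlt (min_le_right _ _)).le
  obtain ⟨τ₁, hτ₁, hstep⟩ := hRR σ hσ hσR' M hM
  refine ⟨τ₁, hτ₁, fun T ρ θ u hsol hmass Φ s hs t ht hguard δ hδ => ?_⟩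
  have htT : t ∈ Ico 0 T := ⟨hs.1.trans ht.1, lt_of_lt_of_le ht.2 (min_le_left _ _)⟩
  -- guards at the finer thresholds
  have hguardR : ∀ s' ∈ Set.Icc s t, ∀ x, ρ s' x * σ ^ 3 < ηR ∧ ρ s' x ≤ M ∧ θ s' x ≤ M ∧
      M⁻¹ ≤ θ s' x ∧ ‖u s' x‖ ≤ M ∧ ∀ i j k : Fin 3, |Torus.partialDeriv i (ρ s') x| ≤ M ∧
      ‖Torus.partialDeriv i (u s') x‖ ≤ M ∧ |Torus.partialDeriv i (θ s') x| ≤ M ∧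
      |Torus.partialDeriv i (Torus.partialDeriv j (ρ s')) x| ≤ M ∧
      ‖Torus.partialDeriv i (Torus.partialDeriv j (u s')) x‖ ≤ M ∧
      |Torus.partialDeriv i (Torus.partialDeriv j (θ s')) x| ≤ M ∧
      |Torus.partialDeriv i (Torus.partialDeriv j (Torus.partialDeriv k (ρ s'))) x| ≤ M ∧
      ‖Torus.partialDeriv i (Torus.partialDeriv j (Torus.partialDeriv k (u s'))) x‖ ≤ M ∧
      |Torus.partialDeriv i (Torus.partialDeriv j (Torus.partialDeriv k (θ s'))) x| ≤ M :=
    fun s' hs' x => ⟨(hguard s' hs' x).1.trans_le (min_le_left _ _), (hguard s' hs' x).2⟩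
  have hpackS : ∀ x, ρ t x * σ ^ 3 ≤ ηS := fun x =>
    ((hguard t ⟨ht.1, le_rfl⟩ x).1.trans_le ((min_le_right _ _).trans (min_le_left _ _))).le
  have hpackE : ∀ x, ρ t x * σ ^ 3 < ηE := fun x =>
    (hguard t ⟨ht.1, le_rfl⟩ x).1.trans_le ((min_le_right _ _).trans (min_le_right _ _))
  -- data at time `t` (and `s`)
  have hρc : Continuous (ρ t) := (hsol.smooth_density.isSmooth_slice htT).continuous
  have huc : Continuous (u t) := (hsol.smooth_velocity.isSmooth_slice htT).continuous
  have hθc : Continuous (θ t) := (hsol.smooth_temperature.isSmooth_slice htT).continuous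
  have hρ0 : ∀ x, 0 < ρ t x := hsol.density_pos t htT
  have hθ0 : ∀ x, 0 < θ t x := hsol.temperature_pos t htT
  have hAc : Continuous fun x => ρ t x * Real.exp (hsExcessFreeEnergy (ρ t x * σ ^ 3) +
      ρ t x * σ ^ 3 * deriv hsExcessFreeEnergy (ρ t x * σ ^ 3)) :=
    continuous_lda_of_band hfc hdc hσ hρc hρ0 hpackE
  have hA0 : ∀ x, 0 < ρ t x * Real.exp (hsExcessFreeEnergy (ρ t x * σ ^ 3) +
      ρ t x * σ ^ 3 * deriv hsExcessFreeEnergy (ρ t x * σ ^ 3)) := fun x => mul_pos (hρ0 x) (Real.exp_pos _)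
  have hsT' : s ∈ Ico 0 T := hs
  have hρcs : Continuous (ρ s) := (hsol.smooth_density.isSmooth_slice hs).continuous
  have hucs : Continuous (u s) := (hsol.smooth_velocity.isSmooth_slice hs).continuous
  have hθcs : Continuous (θ s) := (hsol.smooth_temperature.isSmooth_slice hs).continuous
  have hθ0s : ∀ x, 0 < θ s x := hsol.temperature_pos s hs
  have hpackEs : ∀ x, ρ s x * σ ^ 3 < ηE := fun x =>
    (hguard s ⟨le_rfl, ht.1⟩ x).1.trans_le ((min_le_right _ _).trans (min_le_right _ _))
  have hAcs : Continuous fun x => ρ s x * Real.exp (hsExcessFreeEnergy (ρ s x * σ ^ 3) +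
      ρ s x * σ ^ 3 * deriv hsExcessFreeEnergy (ρ s x * σ ^ 3)) :=
    continuous_lda_of_band hfc hdc hσ hρcs (hsol.density_pos s hs) hpackEs
  have hA0s : ∀ x, 0 < ρ s x * Real.exp (hsExcessFreeEnergy (ρ s x * σ ^ 3) +
      ρ s x * σ ^ 3 * deriv hsExcessFreeEnergy (ρ s x * σ ^ 3)) := fun x =>
    mul_pos (hsol.density_pos s hs x) (Real.exp_pos _)
  -- the static anchor at time `t`: `G_t(A_N) ≤ C_t e^{-(N+1)/C_t}`
  obtain ⟨Ct, hCt, hstat⟩ := hS σ hσ hσ2 (ρ t) (θ t) (u t) hρc hθc huc hρ0 hθ0 (hmass t htT) hpackS δ hδ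
  -- the Rényi bound at precision `ε := 1/(2 C_t)`
  obtain ⟨γ, hγ, hev⟩ := hstep T ρ θ u hsol hmass Φ s hs t ht hguardR (1 / (2 * Ct)) (by positivity)
  obtain ⟨N₀, hN₀⟩ := eventually_atTop.1 hev
  -- the constant
  set r : ℝ := 1 / (1 + γ⁻¹) / (2 * Ct) with hr
  have hr0 : 0 < r := by positivity
  set K : ℝ := Ct ^ (1 / (1 + γ⁻¹)) with hK
  have hK0 : 0 < K := Real.rpow_pos_of_pos hCt _
  set C : ℝ := max (max K r⁻¹) (max (N₀ : ℝ) 3) with hC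
  have hC3 : 3 ≤ C := (le_max_right _ _).trans (le_max_right _ _)
  have hC0 : 0 < C := by linarith
  have hCK : K ≤ C := (le_max_left _ _).trans (le_max_left _ _)
  have hCr : r⁻¹ ≤ C := (le_max_right _ _).trans (le_max_left _ _)
  have hCN : (N₀ : ℝ) ≤ C := (le_max_left _ _).trans (le_max_right _ _)
  refine ⟨C, hC0, fun N => ?_⟩
  -- the laws
  haveI hGs : IsProbabilityMeasure (localGibbsLaw σ (fun x => ρ s x * Real.exp (hsExcessFreeEnergy
      (ρ s x * σ ^ 3) + ρ s x * σ ^ 3 * deriv hsExcessFreeEnergy (ρ s x * σ ^ 3))) (u s) (θ s) N (Φ N)) :=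
    isProbabilityMeasure_localGibbsLaw hAcs hθcs hucs hA0s hθ0s hσ2 N (Φ N)
  haveI hGt : IsProbabilityMeasure (localGibbsLaw σ (fun x => ρ t x * Real.exp (hsExcessFreeEnergy
      (ρ t x * σ ^ 3) + ρ t x * σ ^ 3 * deriv hsExcessFreeEnergy (ρ t x * σ ^ 3))) (u t) (θ t) N (Φ N)) :=
    isProbabilityMeasure_localGibbsLaw hAc hθc huc hA0 hθ0 hσ2 N (Φ N)
  haveI hP : IsProbabilityMeasure ((Φ N).lawAt (localGibbsLaw σ (fun x => ρ s x * Real.exp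
      (hsExcessFreeEnergy (ρ s x * σ ^ 3) + ρ s x * σ ^ 3 * deriv hsExcessFreeEnergy (ρ s x * σ ^ 3)))
      (u s) (θ s) N (Φ N)) (t - s)) := isProbabilityMeasure_lawAt (Φ N) _ (t - s)
  -- the event at time `t` and its preimage under the flow
  set A : Set (Config (N + 1) (Fin 3) T3) := {z | ((N : ℝ) + 1)⁻¹ * ∑ i, Real.log (localGibbsProfile
      (fun x => ρ t x * Real.exp (hsExcessFreeEnergy (ρ t x * σ ^ 3) +
        ρ t x * σ ^ 3 * deriv hsExcessFreeEnergy (ρ t x * σ ^ 3))) (u t) (θ t) (z i)) <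
      (∫ x, ρ t x * (Real.log (ρ t x * Real.exp (hsExcessFreeEnergy (ρ t x * σ ^ 3) +
        ρ t x * σ ^ 3 * deriv hsExcessFreeEnergy (ρ t x * σ ^ 3))) -
        3 / 2 * Real.log (2 * Real.pi * θ t x) - 3 / 2)) - δ} with hA_def
  have hAm : MeasurableSet A := by
    refine measurableSet_lt (measurable_const.mul (Finset.measurable_sum _ fun i _ => ?_)) measurable_const
    exact Real.measurable_log.comp ((measurable_localGibbsProfile hAc hθc huc).comp (measurable_pi_apply i))
  have hpre : localGibbsLaw σ (fun x => ρ s x * Real.exp (hsExcessFreeEnergy (ρ s x * σ ^ 3) +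
      ρ s x * σ ^ 3 * deriv hsExcessFreeEnergy (ρ s x * σ ^ 3))) (u s) (θ s) N (Φ N)
      {z | ((N : ℝ) + 1)⁻¹ * ∑ i, Real.log (localGibbsProfile
        (fun x => ρ t x * Real.exp (hsExcessFreeEnergy (ρ t x * σ ^ 3) +
          ρ t x * σ ^ 3 * deriv hsExcessFreeEnergy (ρ t x * σ ^ 3))) (u t) (θ t)
        ((Φ N).flow (t - s) z i)) <
        (∫ x, ρ t x * (Real.log (ρ t x * Real.exp (hsExcessFreeEnergy (ρ t x * σ ^ 3) +
          ρ t x * σ ^ 3 * deriv hsExcessFreeEnergy (ρ t x * σ ^ 3))) -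
          3 / 2 * Real.log (2 * Real.pi * θ t x) - 3 / 2)) - δ} ≤
      (Φ N).lawAt (localGibbsLaw σ (fun x => ρ s x * Real.exp (hsExcessFreeEnergy (ρ s x * σ ^ 3) +
        ρ s x * σ ^ 3 * deriv hsExcessFreeEnergy (ρ s x * σ ^ 3))) (u s) (θ s) N (Φ N)) (t - s) A := by
    rw [HardSphereFlow.lawAt_eq]
    exact Measure.le_map_apply ((Φ N).measurable_flow (t - s)).aemeasurable A
  refine hpre.trans ?_
  -- small `N`: the bound is at least one
  by_cases hNsmall : N < N₀
  · have hN1 : ((N : ℝ) + 1) ≤ C := by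
      have : (N : ℝ) + 1 ≤ N₀ := by exact_mod_cast hNsmall
      exact this.trans hCN
    calc _ ≤ (1 : ℝ≥0∞) := prob_le_one
      _ ≤ ENNReal.ofReal (C * Real.exp (-(C⁻¹ * (N + 1)))) := by
          rw [← ENNReal.ofReal_one]
          refine ENNReal.ofReal_le_ofReal ?_
          have hexp : Real.exp (-1) ≤ Real.exp (-(C⁻¹ * ((N : ℝ) + 1))) := by
            refine Real.exp_le_exp.2 (neg_le_neg ?_)
            rw [inv_mul_le_iff₀ hC0]
            linarith
          have he : (1 : ℝ) ≤ 3 * Real.exp (-1) := by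
            have h := Real.exp_one_lt_d9
            have h1 : Real.exp (-1) = (Real.exp 1)⁻¹ := Real.exp_neg 1
            rw [h1, ← div_eq_mul_inv, le_div_iff₀ (Real.exp_pos 1)]
            linarith
          calc (1 : ℝ) ≤ 3 * Real.exp (-1) := he
            _ ≤ C * Real.exp (-(C⁻¹ * ((N : ℝ) + 1))) :=
                mul_le_mul hC3 hexp (Real.exp_pos _).le hC0.le
  -- large `N`: Rényi change of measure against the static anchor
  have hN : N₀ ≤ N := not_lt.1 hNsmall
  have hRN := hN₀ N hN
  -- generalize the two laws (plain variables, so that the instances are found)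
  obtain ⟨P, hP_def⟩ : ∃ P : Measure (Config (N + 1) (Fin 3) T3), P = (Φ N).lawAt (localGibbsLaw σ
      (fun x => ρ s x * Real.exp (hsExcessFreeEnergy (ρ s x * σ ^ 3) +
        ρ s x * σ ^ 3 * deriv hsExcessFreeEnergy (ρ s x * σ ^ 3))) (u s) (θ s) N (Φ N)) (t - s) := ⟨_, rfl⟩
  obtain ⟨Q, hQ_def⟩ : ∃ Q : Measure (Config (N + 1) (Fin 3) T3), Q = localGibbsLaw σ
      (fun x => ρ t x * Real.exp (hsExcessFreeEnergy (ρ t x * σ ^ 3) +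
        ρ t x * σ ^ 3 * deriv hsExcessFreeEnergy (ρ t x * σ ^ 3))) (u t) (θ t) N (Φ N) := ⟨_, rfl⟩
  haveI hPi : IsProbabilityMeasure P := by rw [hP_def]; infer_instance
  haveI hQi : IsProbabilityMeasure Q := by rw [hQ_def]; infer_instance
  rw [← hP_def]
  have hb0 : (0 : ℝ) ≤ ((N : ℝ) + 1) / (2 * Ct) := by positivity
  have hRN' : renyiDiv (1 + γ) P Q ≤ ENNReal.ofReal (((N : ℝ) + 1) / (2 * Ct)) := by
    rw [hP_def, hQ_def]
    refine hRN.trans (le_of_eq ?_)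
    rw [show ((N : ℝ) + 1) / (2 * Ct) = 1 / (2 * Ct) * ((N : ℝ) + 1) by ring,
      ENNReal.ofReal_mul (by positivity)]
    congr 1
    rw [ENNReal.ofReal_add (by positivity) zero_le_one, ENNReal.ofReal_natCast, ENNReal.ofReal_one]
  have hH := hellingerIntegral_le_of_renyiDiv_le hγ hb0 hRN'
  -- `P ≪ Q` from the finiteness of the Hellinger integral
  have hPQ : P ≪ Q := by
    have h1 : hellingerIntegral (1 + γ) P Q ≠ ∞ := ne_top_of_le_ne_top ENNReal.ofReal_ne_top hH
    rw [hellingerIntegral, if_pos (by linarith : (1 : ℝ) < 1 + γ), ENNReal.add_ne_top] at h1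
    have h2 : P.singularPart Q univ = 0 := by
      by_contra h0
      exact h1.2 (ENNReal.top_mul h0)
    -- (the `HaveLebesgueDecomposition` instance is given by hand: instance synthesis re-derives the
    -- measurable structure of the torus through the quotient and misses the one carried by the laws)
    haveI : P.HaveLebesgueDecomposition Q := Measure.haveLebesgueDecomposition_of_sigmaFinite P Q
    rwa [Measure.measure_univ_eq_zero, Measure.singularPart_eq_zero] at h2
  have hchange := measure_le_hellinger_rpow_mul_rpow P Q hPQ hγ hAm
  have hQA : Q A ≤ ENNReal.ofReal (Ct * Real.exp (-(Ct⁻¹ * ((N : ℝ) + 1)))) := by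
    rw [hQ_def]; exact hstat N (Φ N)
  have hp : (0 : ℝ) ≤ 1 / (1 + γ) := by positivity
  have hq : (0 : ℝ) ≤ 1 / (1 + γ⁻¹) := by positivity
  calc P A ≤ hellingerIntegral (1 + γ) P Q ^ (1 / (1 + γ)) * Q A ^ (1 / (1 + γ⁻¹)) := hchange
    _ ≤ ENNReal.ofReal (Real.exp (γ * (((N : ℝ) + 1) / (2 * Ct)))) ^ (1 / (1 + γ)) *
        ENNReal.ofReal (Ct * Real.exp (-(Ct⁻¹ * ((N : ℝ) + 1)))) ^ (1 / (1 + γ⁻¹)) := by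
        gcongr
    _ = ENNReal.ofReal (K * Real.exp (-(r * ((N : ℝ) + 1)))) := by
        rw [ENNReal.ofReal_rpow_of_nonneg (Real.exp_pos _).le hp,
          ENNReal.ofReal_rpow_of_nonneg (by positivity) hq, ← ENNReal.ofReal_mul (by positivity),
          tightness_bookkeeping hγ hCt, ← hK, ← hr]
    _ ≤ ENNReal.ofReal (C * Real.exp (-(C⁻¹ * (N + 1)))) := by
        refine ENNReal.ofReal_le_ofReal (mul_le_mul hCK (Real.exp_le_exp.2 (neg_le_neg ?_))
          (Real.exp_pos _).le hC0.le)
        refine mul_le_mul_of_nonneg_right ?_ (by positivity)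
        calc C⁻¹ ≤ (r⁻¹)⁻¹ := inv_anti₀ (inv_pos.2 hr0) hCr
          _ = r := inv_inv r

end Summit.AtomisticToContinuum.HydrodynamicLimit.Theorems.RestartPrinciple.IsentropicRegibbsification

end
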